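import Mathlib.MeasureTheory.Integral.Bochner.Basic
import Mathlib.Order.Lattice.Nat
import Literature.Probability.LatticeModels.ObliqueMedialAbsorb
import HarnessLib

/-!
# The tip-balance sum along the medial exploration of critical bond percolation on `δℤ²`

The object `tipBalanceSum` (definition D2) posited by route `CriticalPhenomena/CardyObliqueExplorer`
(card `oblique-harmonic-explorer-2`, identity (2)), built on the oblique medial walk of
`Literature/Probability/LatticeModels/ObliqueMedialAbsorb.lean` (definition D1: `obliqueMedialAbsorb` =
`u`, `obliqueMedialArrive` = `w_f`, `obliqueMedialDoob` = `c(f)`, `obliqueMedialCCell` = `c_δ`).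

Setting (Smirnov 2001, §2, square-lattice version, as rendered by G02's `MedialInterface.lean`): a
conformal rectangle `R = (Ω; a, b, c, d)`, a square-lattice Dobrushin datum `D` of its chord `(a, c)`
(wired arc `A ≈ (abc)`, dual-wired arc `B ≈ (cda)`; in the route, `D = E δ` for an admissible
discretising family `E`, or the canonical `acDobrushinData R δ`), critical bond percolation
`P_{1/2} = bondPercolation (zdGraph 2) half`, and the medial exploration `medialExploration D ω₀`
(a list of medial vertices = primal edges = the cells it examines, in order; junk `[]` when it is
not uniquely defined).

Bookkeeping (Schramm–Sheffield 2005, §3.1 Lemma 1 and §4: along the explorer the observable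
`h_n(v)` changes only through the value revealed at the fresh cell, `E[h_m(v) − h_n(v) | γ[0,n]] = 0`;
here the coin is the FAIR percolation coin instead of the harmonic one, so each fresh cell `f_n`
contributes the conditional drift `½ · w_{f_n}(c_δ) · (c(f_n) − 2 u(f_n))` — the route's support item
DoobIdentity, NOT proved here):

* `acMedialExploration R D ω₀ = γ` — the exploration re-oriented to run `a → c` by the endpoint rule
  of the route's typed items (`TipBalance.acOrient`: keep the list if its head is at least as close
  to `a = R.pt 0` as to `c = R.pt 2`, reverse it otherwise; the list version of `orientCurve`);
* `TipBalance.firstTouch S γ` — the first index `n` at which the cell `γ[n]` has an endpoint in `S`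
  (`γ.length` if none), and `tipBalanceStop R D ω₀ = T` — the first step at which `γ` examines a
  cell touching the discrete arcs of `(bc) ∪ (cd)` (`TipBalance.bcdSites`), the step deciding the
  typed event "a `(cd)`-edge is examined before any `(bc)`-edge" of `CrossingHitDictionary` /
  `ExplorationCardy` (`TipBalance.exists_examines_before_iff`);
* the summands: with revealed data `(D.bcBondConfig ω₀, γ.take n)` (the walk reads the open/closed
  type of the revealed cells `γ[1], …, γ[n−1]` off the completed configuration; `γ[n−1]` is the tip)
  and fresh cell `f_n = γ[n]`: the weight `tipBalanceWeight R D ω₀ n = w^{(n)}_{f_n}(c_δ)`, the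
  stencil `tipBalanceStencil R D ω₀ n = c^{(n)}(f_n) − 2 u^{(n)}(f_n)` and the summand
  `tipBalanceSummand R D ω₀ n = s_n` (their product at a FIRST visit, `0` at a revisit — the turn
  at a cell already examined is forced — and `0` beyond the path); the deterministic versions for
  given revealed data are `TipBalance.tipWeightOf` / `tipStencilOf` / `tipSummandOf`;
* `tipBalancePathSum R D ω₀ = Σ_{n<T} s_n` and
  `tipBalanceSum R D = E_{1/2}[Σ_{n<T} s_n] = ∫ ω₀, tipBalancePathSum R D ω₀ ∂P_{1/2}`;
  `tipBalanceSumFixed R δ` is its value on the canonical data `acDobrushinData R δ`.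

Junk values (documented in place): `γ = []` (non-admissible datum) gives `T = 0` and path sum `0`
(`tipBalancePathSum_of_eq_nil`), matching `medialExploration`'s junk; the Bochner integral is `0`
for a non-integrable integrand (for bounded `Ω` and `δ > 0` the integrand takes finitely many values
on cylinder events; measurability is for the users to supply, as for `medialExplorationLaw`). The
`n = 0` term concerns the starting `A`–`B` edge `e_a = γ[0]`, which the walk's typing never treats
as revealed (`ObliqueMedial.rawKind` reads `pref.tail`); it vanishes whenever `e_a` is a killing
cell not within `2δ` of `b` (then `u(e_a) = c(e_a) = 0`).

NOT here: no claim about the sign, size or limit of the sum (items TipBalance, DoobIdentity,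
KernelDominance of the route), no measurability or integrability statement.

## References

* O. Schramm, S. Sheffield, *Harmonic explorer and its convergence to SLE₄*, Ann. Probab. 33
  (2005), §3.1 (construction, Lemma 1: `h_n(v)` is a martingale), §4 (the increments
  `h_m(v) − h_n(v)` along the path) [SchrammSheffield2005].
* S. Smirnov, *Critical percolation in the plane*, C. R. Acad. Sci. Paris 333 (2001), §2 (the
  exploration process; discrete arcs) [Smirnov2001].
* F. Camia, C. M. Newman, Probab. Theory Related Fields 139 (2007), §2 (the exploration path from
  `a_δ` to `b_δ`: the endpoint orientation) [CamiaNewman2007].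
* Card `Summits/CriticalPhenomena/CardyFormulaZ2/Ideas/oblique-harmonic-explorer-2.md`, identity (2).
-/

noncomputable section

open MeasureTheory

namespace Literature.Probability.Percolation

open LatticeModels LatticeModels.ObliqueMedial

variable (R : RandomPlanarGeometry.ConformalRectangle) (D : DiscreteDobrushin)

namespace TipBalance

/-! ### The `a → c` orientation of a medial path (helper namespace `TipBalance`) -/

open scoped Classical in
/-- **Endpoint rule on lists of medial vertices.** Keep `l` if its head (at mesh `δ`) is at least as
close to `a = R.pt 0` as to `c = R.pt 2` (vacuously for `l = []`), reverse it otherwise — verbatim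
the re-orientation used in the typed event of the route's item `CrossingHitDictionary`, and the list
analogue of `orientCurve` (Camia–Newman 2007, §2: the exploration path from `a_δ`).
[cite: CamiaNewman2007, §2] -/
def acOrient (δ : ℝ) (l : List MedialVertex) : List MedialVertex :=
  if ∀ e₀ ∈ l.head?, dist (medialPoint δ e₀) (R.pt 0) ≤ dist (medialPoint δ e₀) (R.pt 2) then l
  else l.reverse

/-- The empty path stays empty. [folklore] -/
@[simp] theorem acOrient_nil (δ : ℝ) : acOrient R δ [] = [] := by
  simp [acOrient]

/-- `acOrient` returns the list or its reversal. [folklore] -/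
theorem acOrient_eq_or (δ : ℝ) (l : List MedialVertex) :
    acOrient R δ l = l ∨ acOrient R δ l = l.reverse := by
  unfold acOrient
  split_ifs
  · exact Or.inl rfl
  · exact Or.inr rfl

/-- Re-orientation preserves the length. [folklore] -/
@[simp] theorem length_acOrient (δ : ℝ) (l : List MedialVertex) :
    (acOrient R δ l).length = l.length := by
  rcases acOrient_eq_or R δ l with h | h <;> simp [h]

/-- Re-orientation preserves the set of cells. [folklore] -/
@[simp] theorem mem_acOrient {δ : ℝ} {l : List MedialVertex} {e : MedialVertex} :
    e ∈ acOrient R δ l ↔ e ∈ l := by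
  rcases acOrient_eq_or R δ l with h | h <;> simp [h]

end TipBalance

open TipBalance

/-- **The `a → c`-oriented medial exploration** `γ` of the configuration `ω₀` in the Dobrushin datum
`D` of the chord `(a, c)` of `R`: G02's `medialExploration D ω₀` (wired arc on its left; junk `[]`
unless uniquely defined), re-oriented by the endpoint rule `acOrient R D.δ` so that it starts at the
`A`–`B` edge `e_a` near `a` (for a discretising family `(E δ).δ = δ`, literally the list `l'` of the
typed event of `CrossingHitDictionary`). `γ[n]` is the cell examined at step `n`. (Smirnov 2001, §2;
Camia–Newman 2007, §2.) [cite: Smirnov2001, §2] -/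
def acMedialExploration (ω₀ : BondConfig (Site 2)) : List MedialVertex :=
  TipBalance.acOrient R D.δ (medialExploration D ω₀)

open scoped Classical in
/-- Unfolding `acMedialExploration` into the `if … then l else l.reverse` form of the route's typed
event. [folklore] -/
theorem acMedialExploration_eq_ite (ω₀ : BondConfig (Site 2)) :
    acMedialExploration R D ω₀ =
      if ∀ e₀ ∈ (medialExploration D ω₀).head?,
          dist (medialPoint D.δ e₀) (R.pt 0) ≤ dist (medialPoint D.δ e₀) (R.pt 2)
      then medialExploration D ω₀ else (medialExploration D ω₀).reverse :=
  rfl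

/-- Junk in, junk out: if the exploration is not (uniquely) defined, the oriented path is `[]`.
[folklore] -/
theorem acMedialExploration_of_eq_nil {ω₀ : BondConfig (Site 2)} (h : medialExploration D ω₀ = []) :
    acMedialExploration R D ω₀ = [] := by
  simp [acMedialExploration, h]

/-! ### The stopping step: first cell touching the discrete arcs of `(bc) ∪ (cd)` -/

namespace TipBalance

/-- The sites of the discrete arcs of `(bc) = R.arc 1` and `(cd) = R.arc 2` in the datum `D`
(`DiscreteDobrushin.zdDiscreteArc`). Examining a cell with an endpoint here decides the hitting
event of the route. (Smirnov 2001, §2: discrete arcs.) [cite: Smirnov2001, §2] -/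
def bcdSites : Set (Site 2) := D.zdDiscreteArc (R.arc 1) ∪ D.zdDiscreteArc (R.arc 2)

/-- **First touching index.** The least `n` such that the cell `γ[n]` touches `S`
(`ObliqueMedial.Touches`: one of its endpoints lies in `S`); indices beyond the path qualify
vacuously, so the value is `γ.length` when no cell of `γ` touches `S` (`sInf` form). [folklore] -/
def firstTouch (S : Set (Site 2)) (γ : List MedialVertex) : ℕ :=
  sInf {n | ∀ e ∈ γ[n]?, Touches e S}

/-- The index `γ.length` qualifies vacuously. [folklore] -/
theorem length_mem_setOf_touches (S : Set (Site 2)) (γ : List MedialVertex) :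
    γ.length ∈ {n | ∀ e ∈ γ[n]?, Touches e S} := by
  show ∀ e ∈ γ[γ.length]?, Touches e S
  rw [List.getElem?_eq_none le_rfl]
  simp

/-- `firstTouch S γ ≤ γ.length`. [folklore] -/
theorem firstTouch_le_length (S : Set (Site 2)) (γ : List MedialVertex) :
    firstTouch S γ ≤ γ.length :=
  Nat.sInf_le (length_mem_setOf_touches S γ)

/-- On the empty path the first touching index is `0`. [folklore] -/
@[simp] theorem firstTouch_nil (S : Set (Site 2)) : firstTouch S [] = 0 :=
  Nat.le_zero.mp (firstTouch_le_length S [])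

/-- The defining property at the first touching index (vacuous beyond the path). [folklore] -/
theorem forall_touches_firstTouch (S : Set (Site 2)) (γ : List MedialVertex) :
    ∀ e ∈ γ[firstTouch S γ]?, Touches e S :=
  Nat.sInf_mem (s := {n | ∀ e ∈ γ[n]?, Touches e S}) ⟨γ.length, length_mem_setOf_touches S γ⟩

/-- If `firstTouch S γ` is an index of the path, the cell there touches `S`. [folklore] -/
theorem touches_getElem_firstTouch {S : Set (Site 2)} {γ : List MedialVertex}
    (h : firstTouch S γ < γ.length) : Touches γ[firstTouch S γ] S :=
  forall_touches_firstTouch S γ _ (Option.mem_def.mpr (List.getElem?_eq_getElem h))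

/-- Before `firstTouch S γ` no cell touches `S`. [folklore] -/
theorem not_touches_of_lt_firstTouch {S : Set (Site 2)} {γ : List MedialVertex} {m : ℕ}
    (hm : m < firstTouch S γ) {e : MedialVertex} (he : e ∈ γ[m]?) : ¬ Touches e S := by
  intro hS
  have hnot : m ∉ {n | ∀ e ∈ γ[n]?, Touches e S} := Nat.notMem_of_lt_sInf hm
  apply hnot
  show ∀ e' ∈ γ[m]?, Touches e' S
  intro e' he'
  rw [Option.mem_def] at he he'
  rw [he] at he'
  cases he'
  exact hS

/-- Existence of a touching cell bounds the first touching index. [folklore] -/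
theorem firstTouch_le_of_touches {S : Set (Site 2)} {γ : List MedialVertex} {n : ℕ}
    {e : MedialVertex} (he : e ∈ γ[n]?) (hS : Touches e S) : firstTouch S γ ≤ n := by
  refine Nat.sInf_le (s := {n | ∀ e ∈ γ[n]?, Touches e S}) ?_
  show ∀ e' ∈ γ[n]?, Touches e' S
  intro e' he'
  rw [Option.mem_def] at he he'
  rw [he] at he'
  cases he'
  exact hS

/-- **The typed hitting event is decided at the first touching step.** For a path `γ` and two site
sets `A` (to avoid, e.g. the discrete arc of `(bc)`) and `B` (to reach, e.g. the discrete arc of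
`(cd)`): "`γ` examines a cell touching `B` before any cell touching `A`" — in the literal form of
the route's item `CrossingHitDictionary` — iff the first index at which `γ` touches `A ∪ B` is an
index of the path and the cell there touches `B`. [folklore] -/
theorem exists_examines_before_iff (A B : Set (Site 2)) (γ : List MedialVertex) :
    (∃ n : ℕ, ∃ e ∈ γ[n]?, (∃ v ∈ e, v ∈ B) ∧ ∀ m < n, ∀ e' ∈ γ[m]?, ∀ v ∈ e', v ∉ A) ↔
      ∃ h : firstTouch (A ∪ B) γ < γ.length, ∃ v ∈ γ[firstTouch (A ∪ B) γ]'h, v ∈ B := by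
  constructor
  · rintro ⟨n, e, he, ⟨v, hv, hvB⟩, hA⟩
    obtain ⟨hn, rfl⟩ := List.getElem?_eq_some_iff.mp he
    have hTn : firstTouch (A ∪ B) γ ≤ n :=
      firstTouch_le_of_touches he ⟨v, hv, Or.inr hvB⟩
    have hT : firstTouch (A ∪ B) γ < γ.length := lt_of_le_of_lt hTn hn
    obtain ⟨x, hx, hxAB⟩ := touches_getElem_firstTouch hT
    rcases hxAB with hxA | hxB
    · rcases Nat.lt_or_eq_of_le hTn with hlt | heq
      · exact absurd hxA
          (hA _ hlt _ (Option.mem_def.mpr (List.getElem?_eq_getElem hT)) x hx)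
      · subst heq
        exact ⟨hT, v, hv, hvB⟩
    · exact ⟨hT, x, hx, hxB⟩
  · rintro ⟨hT, v, hv, hvB⟩
    exact ⟨firstTouch (A ∪ B) γ, _, Option.mem_def.mpr (List.getElem?_eq_getElem hT),
      ⟨v, hv, hvB⟩, fun m hm e' he' x hx hxA =>
        not_touches_of_lt_firstTouch hm he' ⟨x, hx, Or.inl hxA⟩⟩

end TipBalance

/-- **The stopping step `T`** of the route: the first step at which the `a → c`-oriented exploration
of `ω₀` examines a cell with an endpoint on the discrete arcs of `(bc) ∪ (cd)` (`bcdSites`), i.e. the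
step at which the typed event "a `(cd)`-edge is examined before any `(bc)`-edge" of
`ExplorationCardy` / `CrossingHitDictionary` is decided (`exists_examines_before_iff` with
`A = D.zdDiscreteArc (R.arc 1)`, `B = D.zdDiscreteArc (R.arc 2)`); `γ.length` if no such step, `0`
on the junk path `[]`. [cite: Smirnov2001, §2] -/
def tipBalanceStop (ω₀ : BondConfig (Site 2)) : ℕ :=
  TipBalance.firstTouch (TipBalance.bcdSites R D) (acMedialExploration R D ω₀)

/-- `T` is at most the number of examined cells. [folklore] -/
theorem tipBalanceStop_le_length (ω₀ : BondConfig (Site 2)) :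
    tipBalanceStop R D ω₀ ≤ (acMedialExploration R D ω₀).length :=
  TipBalance.firstTouch_le_length _ _

/-! ### The summands `s_n = w^{(n)}_{f_n}(c_δ) · (c^{(n)}(f_n) − 2 u^{(n)}(f_n))` -/

namespace TipBalance

/-- `w_f(c_δ)` for revealed data `(ω, pref)`: the probability that the oblique medial walk started at
the target cell `c_δ = obliqueMedialCCell R D` arrives at the cell `f` before `⊤`/`⊥`
(`obliqueMedialArrive`). [cite: SchrammSheffield2005, §3.1 Lemma 1] -/
def tipWeightOf (ω : Set MedialVertex) (pref : List MedialVertex) (f : MedialVertex) : ℝ :=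
  obliqueMedialArrive R D ω pref f (obliqueMedialCCell R D)

/-- The weight is a probability: `w_f(c_δ) ∈ [0, 1]` (`obliqueMedialArrive_mem_Icc`). [folklore] -/
theorem tipWeightOf_mem_Icc (ω : Set MedialVertex) (pref : List MedialVertex) (f : MedialVertex) :
    tipWeightOf R D ω pref f ∈ Set.Icc (0 : ℝ) 1 :=
  obliqueMedialArrive_mem_Icc R D ω pref f _

/-- The tip stencil `c(f) − 2 u(f)` for revealed data `(ω, pref)`: `c(f) = obliqueMedialDoob` (the
value of `f` once revealed open, reflecting from the tip `pref.getLast?`) and `u(f) =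
obliqueMedialAbsorb` (the current value of `f`); `½ (c(f) − 2u(f)) · w_f` is the mean of the two
rank-one updates `(c(f) − u(f)) · w_f` (open) and `−u(f) · w_f` (closed) under a fair coin (card
identity (2)). [cite: SchrammSheffield2005, §3.1 Lemma 1] -/
def tipStencilOf (ω : Set MedialVertex) (pref : List MedialVertex) (f : MedialVertex) : ℝ :=
  obliqueMedialDoob R D ω pref f - 2 * obliqueMedialAbsorb R D ω pref f

/-- The summand for revealed data `(ω, pref)` and fresh cell `f`: `w_f(c_δ) · (c(f) − 2u(f))` at a
first visit, `0` if `f` was already examined (`f ∈ pref`: the turn is forced and nothing is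
revealed). [cite: SchrammSheffield2005, §4] -/
def tipSummandOf (ω : Set MedialVertex) (pref : List MedialVertex) (f : MedialVertex) : ℝ :=
  if f ∈ pref then 0 else tipWeightOf R D ω pref f * tipStencilOf R D ω pref f

/-- A revisited cell contributes `0`. [folklore] -/
theorem tipSummandOf_of_mem {ω : Set MedialVertex} {pref : List MedialVertex} {f : MedialVertex}
    (h : f ∈ pref) : tipSummandOf R D ω pref f = 0 := by
  simp [tipSummandOf, h]

/-- A fresh cell contributes `w_f(c_δ) · (c(f) − 2u(f))`. [folklore] -/
theorem tipSummandOf_of_not_mem {ω : Set MedialVertex} {pref : List MedialVertex}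
    {f : MedialVertex} (h : f ∉ pref) :
    tipSummandOf R D ω pref f = tipWeightOf R D ω pref f * tipStencilOf R D ω pref f := by
  simp [tipSummandOf, h]

end TipBalance

/-- **The weight `w^{(n)}_{f_n}(c_δ)`** along the exploration of `ω₀`, as a random variable: the
revealed data after `n` steps are the completed configuration `D.bcBondConfig ω₀` (read only on
revealed cells) and the prefix `γ.take n = [γ[0], …, γ[n−1]]` of the oriented exploration (tip
`γ[n−1]`), the fresh cell is `f_n = γ[n]`; `0` beyond the path. Exposed for the layer-2 item
WeightBudget. [cite: SchrammSheffield2005, §4] -/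
def tipBalanceWeight (ω₀ : BondConfig (Site 2)) (n : ℕ) : ℝ :=
  match (acMedialExploration R D ω₀)[n]? with
  | none => 0
  | some f => TipBalance.tipWeightOf R D (D.bcBondConfig ω₀) ((acMedialExploration R D ω₀).take n) f

/-- The weights lie in `[0, 1]` (the input of the weight budget `Σ_n w^{(n)}_{f_n}(c_δ)`).
[folklore] -/
theorem tipBalanceWeight_mem_Icc (ω₀ : BondConfig (Site 2)) (n : ℕ) :
    tipBalanceWeight R D ω₀ n ∈ Set.Icc (0 : ℝ) 1 := by
  unfold tipBalanceWeight
  split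
  · simp
  · exact tipWeightOf_mem_Icc R D _ _ _

/-- **The stencil `c^{(n)}(f_n) − 2 u^{(n)}(f_n)`** along the exploration of `ω₀` (same revealed
data as `tipBalanceWeight`); `0` beyond the path. Exposed for the layer-2 item TipStencilDecay.
[cite: SchrammSheffield2005, §4] -/
def tipBalanceStencil (ω₀ : BondConfig (Site 2)) (n : ℕ) : ℝ :=
  match (acMedialExploration R D ω₀)[n]? with
  | none => 0
  | some f => TipBalance.tipStencilOf R D (D.bcBondConfig ω₀) ((acMedialExploration R D ω₀).take n) f

/-- **The summand `s_n`** along the exploration of `ω₀`: `w^{(n)}_{f_n}(c_δ) · (c^{(n)}(f_n) −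
2 u^{(n)}(f_n))` if step `n` is the FIRST visit of the cell `f_n = γ[n]`, `0` at a revisit
(`γ[n] ∈ γ.take n`: forced turn, nothing revealed) and `0` beyond the path (`tipSummandOf` on the
revealed data `(D.bcBondConfig ω₀, γ.take n)`). [cite: SchrammSheffield2005, §4] -/
def tipBalanceSummand (ω₀ : BondConfig (Site 2)) (n : ℕ) : ℝ :=
  match (acMedialExploration R D ω₀)[n]? with
  | none => 0
  | some f => TipBalance.tipSummandOf R D (D.bcBondConfig ω₀) ((acMedialExploration R D ω₀).take n) f

variable {R D} in
/-- Beyond the path the summand is `0`. [folklore] -/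
theorem tipBalanceSummand_of_length_le {ω₀ : BondConfig (Site 2)} {n : ℕ}
    (h : (acMedialExploration R D ω₀).length ≤ n) : tipBalanceSummand R D ω₀ n = 0 := by
  simp [tipBalanceSummand, List.getElem?_eq_none h]

variable {R D} in
/-- At an index of the path, the summand is `tipSummandOf` at the examined cell. [folklore] -/
theorem tipBalanceSummand_of_lt {ω₀ : BondConfig (Site 2)} {n : ℕ}
    (h : n < (acMedialExploration R D ω₀).length) :
    tipBalanceSummand R D ω₀ n =
      tipSummandOf R D (D.bcBondConfig ω₀) ((acMedialExploration R D ω₀).take n)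
        (acMedialExploration R D ω₀)[n] := by
  simp [tipBalanceSummand, List.getElem?_eq_getElem h]

variable {R D} in
/-- At a first visit the summand factors as weight × stencil. [folklore] -/
theorem tipBalanceSummand_eq_weight_mul_stencil {ω₀ : BondConfig (Site 2)} {n : ℕ}
    (h : n < (acMedialExploration R D ω₀).length)
    (hfresh : (acMedialExploration R D ω₀)[n] ∉ (acMedialExploration R D ω₀).take n) :
    tipBalanceSummand R D ω₀ n = tipBalanceWeight R D ω₀ n * tipBalanceStencil R D ω₀ n := by
  simp [tipBalanceSummand, tipBalanceWeight, tipBalanceStencil, List.getElem?_eq_getElem h,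
    tipSummandOf_of_not_mem R D hfresh]

variable {R D} in
/-- At a revisit the summand vanishes. [folklore] -/
theorem tipBalanceSummand_eq_zero_of_mem_take {ω₀ : BondConfig (Site 2)} {n : ℕ}
    (h : n < (acMedialExploration R D ω₀).length)
    (hrev : (acMedialExploration R D ω₀)[n] ∈ (acMedialExploration R D ω₀).take n) :
    tipBalanceSummand R D ω₀ n = 0 := by
  simp [tipBalanceSummand, List.getElem?_eq_getElem h, tipSummandOf_of_mem R D hrev]

/-! ### The path sum and its expectation -/

/-- **The path functional `Σ_{n<T} s_n`**: the tip-balance summands of the exploration of `ω₀`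
summed over the steps before the stopping step `T = tipBalanceStop R D ω₀`; `0` on the junk path.
(Card identity (2); Schramm–Sheffield 2005, §4, for the step-by-step bookkeeping.)
[cite: SchrammSheffield2005, §4] -/
def tipBalancePathSum (ω₀ : BondConfig (Site 2)) : ℝ :=
  ∑ n ∈ Finset.range (tipBalanceStop R D ω₀), tipBalanceSummand R D ω₀ n

variable {R D} in
/-- Junk agreement: when the exploration is not (uniquely) defined (`medialExploration D ω₀ = []`,
e.g. a non-admissible datum) the path sum is `0`. [folklore] -/
theorem tipBalancePathSum_of_eq_nil {ω₀ : BondConfig (Site 2)} (h : medialExploration D ω₀ = []) :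
    tipBalancePathSum R D ω₀ = 0 := by
  have hT : tipBalanceStop R D ω₀ = 0 := by
    rw [tipBalanceStop, acMedialExploration_of_eq_nil R D h, firstTouch_nil]
  simp [tipBalancePathSum, hT]

/-- **The tip-balance sum** `tipBalanceSum R D = E_{1/2}[ Σ_{n<T} w^{(n)}_{f_n}(c_δ) ·
(c^{(n)}(f_n) − 2 u^{(n)}(f_n)) ]` of route `CardyObliqueExplorer` (definition D2; card
`oblique-harmonic-explorer-2`, identity (2)): the expectation under critical bond percolation
`P_{1/2}` on `ℤ²` of the path functional `tipBalancePathSum R D` of the `a → c`-oriented medial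
exploration in the Dobrushin datum `D` of the chord `(a, c)` of the conformal rectangle `R`, where
`u^{(n)}, w^{(n)}, c^{(n)}` are the outputs of the oblique medial walk (`obliqueMedialAbsorb`,
`obliqueMedialArrive`, `obliqueMedialDoob`) with the first `n` examined cells revealed, `f_n` is the
cell examined at step `n` (first visits only), `c_δ = obliqueMedialCCell R D`, and `T` is the first
step examining a cell of the discrete arcs of `(bc) ∪ (cd)`. By the route's DoobIdentity (not proved
here) `P_{1/2}[(cd) examined before (bc)] − u^{(0)}(c_δ) = ½ · tipBalanceSum R D`; the crux TipBalance
asserts `tipBalanceSum R (E δ) → 0` as `δ → 0⁺` for admissible discretising families `E` of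
`R.chord 0 2` (canonical choice `E = acDobrushinData R`). Junk: `0` when the exploration is nowhere
defined; Bochner-integral junk `0` for a non-integrable integrand. After Schramm–Sheffield's
bookkeeping of the explorer martingale (2005, §3.1 Lemma 1, §4), with the fair coin in place of the
harmonic coin. [cite: SchrammSheffield2005, §4] -/
def tipBalanceSum : ℝ :=
  ∫ ω₀, tipBalancePathSum R D ω₀ ∂(bondPercolation (zdGraph 2) half)

/-- Unfolding `tipBalanceSum` as a Bochner integral against `P_{1/2}`. [folklore] -/
theorem tipBalanceSum_def :
    tipBalanceSum R D = ∫ ω₀, tipBalancePathSum R D ω₀ ∂(bondPercolation (zdGraph 2) half) :=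
  rfl

variable {R D} in
/-- Junk agreement: if the exploration is nowhere defined in the datum `D` (e.g. `D` has no
`A`–`B` edge), the tip-balance sum is `0`. [folklore] -/
theorem tipBalanceSum_of_forall_eq_nil (h : ∀ ω₀, medialExploration D ω₀ = []) :
    tipBalanceSum R D = 0 := by
  have h0 : ∀ ω₀, tipBalancePathSum R D ω₀ = 0 := fun ω₀ => tipBalancePathSum_of_eq_nil (h ω₀)
  simp [tipBalanceSum, h0]

/-- The tip-balance sum of the canonical chord-`(a, c)` data `acDobrushinData R δ` at mesh `δ` (the
single-scheme specialisation; the route quantifies over discretising families instead, cf. the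
module docstring of `InterfaceScalingLimitDiscretised.lean`). [cite: SchrammSheffield2005, §4] -/
def tipBalanceSumFixed (δ : ℝ) : ℝ :=
  tipBalanceSum R (acDobrushinData R δ)

end Literature.Probability.Percolation

end
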